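import Summits.HodgeConjecture.HodgeConjecture.Theorems.TropicalWeilObstructionTropicalWeilVanishingVariationalSpan
import Summits.HodgeConjecture.HodgeConjecture.Theorems.TropicalWeilObstructionTropicalWeilVanishingFrameSpanSeeds
import HarnessLib

/-!
# Route `TropicalWeilObstruction` (Kontsevich's tropical test — NEGATION SINK, exploration, no summit claim):
# the VARIATIONAL direction bound — III. the direction count from an independence certificate

Negation-sink bookkeeping of the cell `pub-hodge-tropical` (seat tropical-1 gen 9); part III of the VARIATIONAL series. Part II
puts the whole class surface `{a θ₄(D) + b Re w(D) + c Im w(D) : D ∈ Sym_J(ℤ)}` of an effective tropical `4`-cycle `Z` (very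
general Weil period, integer class coordinates `(a,b,c)`) inside `span_ℝ{p_σ ⊗ p_σ}`. Here:

* `card_image_pluckerCoord_ge_of_independent_directions` — **THE VARIATIONAL DIRECTION BOUND (certificate form)**: given `N`
  integer symmetric `J`-commuting directions `D_i` and `N` coordinate pairs `(S_j, S'_j)` on which the Weil part of the class
  tables vanishes and on which the minors `det D_i[S_j, S'_j]` form a matrix with independent rows, `Z` has at least `N` cells
  with pairwise distinct Plücker vectors (`N` pairwise distinct rational `4`-planes);
* `card_image_pluckerCoord_ge_of_omegaInvisible` — for every NON-EMPTY effective cycle, with coordinate pairs whose second word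
  has `Ω(S'_j) = 0` (there the Weil classes vanish identically);
* `card_image_pluckerCoord_ge_of_weilFunctional_eq_zero` — for cycles with `W(Z) = 0` (then `b = c = 0`), with arbitrary
  coordinate pairs;
* `card_image_pluckerCoord_ge_of_linearlyRealisable`, `obstructed_of_card_image_pluckerCoord_lt` — the SEED form at `Q = 1`
  (transport p341426) and its contrapositive, a rung of `stub_nonflatObstructedAtIdentity`: fewer than `N` distinct Plücker vectors
  ⟹ obstructed at the identity.

NUMBERS (the cell's computation, kit job j181609 and successors; HOME `certificates/variational/`; NOT a theorem of this file):
the class tables of all integer directions span `626` dimensions for every class (`a ≠ 0`), `607` on the `Ω`-invisible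
coordinates; so every non-empty effective tropical `4`-cycle on a very general tropical Weil eightfold — in particular every
seed of the decision criterion p330167 after transport p341426 — has cells in at least `626` pairwise distinct rational
`4`-planes (row (F): `69`). A kernel certificate (explicit `D_i`, `(S_j, S'_j)` and an invertibility proof) would turn the two
corollaries into unconditional numerical bounds; it is not part of this file. HONEST STATUS. Nothing here decides K1 or bears
on the Hodge conjecture. No definition, no named fact, no sorry.

References: [Zharkov2020TropicalWeil] I. Zharkov, arXiv:2002.02347, §2 (pp. 2–4); [MikhalkinZharkov2014Eigenwave] G. Mikhalkin,
I. Zharkov, LN UMI 15 (2014), Def. 4.2, Prop. 4.3, Thm. 5.4.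
-/

set_option linter.dupNamespace false

noncomputable section

open scoped BigOperators Topology
open Matrix Filter
open Literature.AlgebraicGeometry.Tropical
open Summit.HodgeConjecture.HodgeConjecture.Theorems.TropicalHodgeBound

namespace Summit.HodgeConjecture.HodgeConjecture.Theorems.TropicalWeilVanishing.Variational

/-! ## §0 Display-only notation (the K3 skeleton's local definitions, verbatim bodies; nothing is defined) -/

/-- `P = [1 | i·1]`, the `n × 2n` matrix of `dz₁ ∧ … ∧ dz_n`. -/
local notation3 (prettyPrint := false) "𝐏⟦" n "⟧" =>
  (Matrix.of fun (k : Fin n) (a : Fin (2 * n)) =>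
    (if (a : ℕ) = (k : ℕ) then (1 : ℂ) else 0) + (if (a : ℕ) = (k : ℕ) + n then Complex.I else 0))

/-- The skeleton's `thetaClass n Q`. -/
local notation3 (prettyPrint := false) "θ⟦" n "⟧" Q:max =>
  (fun S S' : Fin n → Fin (2 * n) => Matrix.det (Matrix.submatrix Q S S'))

/-- The skeleton's `omegaFrame n` (`Ω = Pᴴ`). -/
local notation3 (prettyPrint := false) "Ω⟦" n "⟧" =>
  (Matrix.of fun (a : Fin (2 * n)) (b : Fin n) =>
    (if (a : ℕ) = (b : ℕ) then (1 : ℂ) else 0) - (if (a : ℕ) = (b : ℕ) + n then Complex.I else 0))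

/-- The skeleton's `weilClassC n Q` (`w(Q) = (⋀ⁿQ ⊗ 1)(Ω ⊗ Ω)`). -/
local notation3 (prettyPrint := false) "wC⟦" n "⟧" Q:max =>
  (fun S S' : Fin n → Fin (2 * n) =>
    Matrix.det (Matrix.submatrix (Matrix.map Q ((↑) : ℝ → ℂ) * Ω⟦n⟧) S id) *
      Matrix.det (Matrix.submatrix (Ω⟦n⟧) S' id))

/-- The skeleton's `weilClassRe n Q` (`w₁ = Re w`). -/
local notation3 (prettyPrint := false) "wRe⟦" n "⟧" Q:max =>
  (fun S S' : Fin n → Fin (2 * n) => Complex.re ((wC⟦n⟧ Q) S S'))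

/-- The skeleton's `weilClassIm n Q` (`w₂ = Im w`). -/
local notation3 (prettyPrint := false) "wIm⟦" n "⟧" Q:max =>
  (fun S S' : Fin n → Fin (2 * n) => Complex.im ((wC⟦n⟧ Q) S S'))

/-- The hermitian MASS `μ(Z) = Σ_σ w_σ a_σ |η_σ|²` of an effective tropical `n`-cycle. Nothing is defined. -/
local notation3 (prettyPrint := false) "μ⟦" n "," Z "⟧" =>
  (∑ σ, ((TropicalTorusCycle.cell Z σ).weight : ℝ) * (TropicalTorusCycle.cell Z σ).latticeVolume *
    ‖frameComplexDet n (TropicalTorusCycle.cell Z σ).frame‖ ^ 2)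

variable (Q : Matrix (Fin (2 * 4)) (Fin (2 * 4)) ℝ)

/-! ## §5 Consequences: the class surface lies in the span of the frame squares; the direction count -/

/-- **Span form.** With the hypotheses of `weilFamilyClass_eq_sum_frameSquares`: for every integer symmetric `J`-commuting
`D`, the table `a θ₄(D) + b Re w(D) + c Im w(D)` lies in the real span of the frame-square tables `p_σ ⊗ p_σ` of the cells
of `Z`. [cite: Zharkov2020TropicalWeil, §2 (pp. 2–4)] [cite: MikhalkinZharkov2014Eigenwave, Prop. 4.3 and Thm. 5.4] -/
theorem weilFamilyClass_mem_span_frameSquares (hQ : Q.PosDef) (hJ : Q * weilJ 4 = weilJ 4 * Q)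
    (hgen : IsWeilGeneric 4 Q) (Z : TropicalTorusCycle (2 * 4) 4 Q) {a b c : ℤ}
    (hq : Z.cyc = (a : ℝ) • θ⟦4⟧ Q + (b : ℝ) • wRe⟦4⟧ Q + (c : ℝ) • wIm⟦4⟧ Q)
    (D : Matrix (Fin (2 * 4)) (Fin (2 * 4)) ℤ) (hDS : (D.map ((↑) : ℤ → ℝ)).IsSymm)
    (hDJr : D.map ((↑) : ℤ → ℝ) * weilJ 4 = weilJ 4 * D.map ((↑) : ℤ → ℝ)) :
    (a : ℝ) • θ⟦4⟧ (D.map ((↑) : ℤ → ℝ)) + (b : ℝ) • wRe⟦4⟧ (D.map ((↑) : ℤ → ℝ)) +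
        (c : ℝ) • wIm⟦4⟧ (D.map ((↑) : ℤ → ℝ)) ∈
      Submodule.span ℝ (Set.range fun σ : Fin Z.numCells => fun S S' : Fin 4 → Fin (2 * 4) =>
        ((pluckerCoord (Z.cell σ).frame S : ℤ) : ℝ) * ((pluckerCoord (Z.cell σ).frame S' : ℤ) : ℝ)) := by
  obtain ⟨coef, h⟩ := weilFamilyClass_eq_sum_frameSquares Q hQ hJ hgen Z hq D hDS hDJr
  rw [h]
  exact Submodule.sum_mem _ fun σ _ => Submodule.smul_mem _ _ (Submodule.subset_span ⟨σ, rfl⟩)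

/-- **THE VARIATIONAL DIRECTION BOUND (certificate form).** Let `Z` be an effective tropical `4`-cycle on a very general
p.p. tropical Weil eightfold with integer class coordinates `(a, b, c)`, `a ≠ 0` (every NON-EMPTY effective cycle,
`Integrality.thetaCoord_pos_int`). Suppose `N` integer symmetric `J`-commuting directions `D_i` and `N` coordinate pairs
`(S_j, S'_j)` are given on which the Weil part of the class tables vanishes (`b Re w(D_i) + c Im w(D_i) = 0` at `(S_j,S'_j)`:
e.g. `Ω(S'_j) = 0`, or `b = c = 0`), and such that the `N × N` real matrix of minors `det D_i[S_j, S'_j]` has linearly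
independent rows. Then the cells of `Z` have at least `N` pairwise distinct Plücker vectors — `Z` has at least `N` cells in
at least `N` pairwise distinct rational `4`-planes (the `N` class tables `a θ₄(D_i) + b Re w(D_i) + c Im w(D_i)` lie in the
span of the frame squares and are linearly independent, reading `a · det D_i[S_j,S'_j]` on the chosen coordinates).
Numerically (seat computation, kit job j181609; representation theory `400 + 225 + 1`): the class tables of ALL integer
directions span `626` dimensions for every class, `607` on the `Ω`-invisible coordinates. Nothing here decides K1 or bears on HC.
[cite: Zharkov2020TropicalWeil, §2 (pp. 2–4)] [cite: MikhalkinZharkov2014Eigenwave, Prop. 4.3 and Thm. 5.4] -/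
theorem card_image_pluckerCoord_ge_of_independent_directions (hQ : Q.PosDef) (hJ : Q * weilJ 4 = weilJ 4 * Q)
    (hgen : IsWeilGeneric 4 Q) (Z : TropicalTorusCycle (2 * 4) 4 Q) {a b c : ℤ}
    (hq : Z.cyc = (a : ℝ) • θ⟦4⟧ Q + (b : ℝ) • wRe⟦4⟧ Q + (c : ℝ) • wIm⟦4⟧ Q) (ha : a ≠ 0) {N : ℕ}
    (D : Fin N → Matrix (Fin (2 * 4)) (Fin (2 * 4)) ℤ) (hDS : ∀ i, ((D i).map ((↑) : ℤ → ℝ)).IsSymm)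
    (hDJ : ∀ i, (D i).map ((↑) : ℤ → ℝ) * weilJ 4 = weilJ 4 * (D i).map ((↑) : ℤ → ℝ))
    (col : Fin N → (Fin 4 → Fin (2 * 4)) × (Fin 4 → Fin (2 * 4)))
    (hcol : ∀ i j, (b : ℝ) * (wRe⟦4⟧ ((D i).map ((↑) : ℤ → ℝ))) (col j).1 (col j).2 +
      (c : ℝ) * (wIm⟦4⟧ ((D i).map ((↑) : ℤ → ℝ))) (col j).1 (col j).2 = 0)
    (hind : LinearIndependent ℝ fun i : Fin N => fun j : Fin N =>
      ((Matrix.det (Matrix.submatrix (D i) (col j).1 (col j).2) : ℤ) : ℝ)) :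
    N ≤ (Finset.univ.image fun σ : Fin Z.numCells => pluckerCoord (Z.cell σ).frame).card ∧ N ≤ Z.numCells := by
  classical
  -- the frame-square tables and their span
  let sq : ((Fin 4 → Fin (2 * 4)) → ℤ) → ((Fin 4 → Fin (2 * 4)) → (Fin 4 → Fin (2 * 4)) → ℝ) :=
    fun p S S' => ((p S : ℤ) : ℝ) * ((p S' : ℤ) : ℝ)
  let T : Finset ((Fin 4 → Fin (2 * 4)) → (Fin 4 → Fin (2 * 4)) → ℝ) :=
    (Finset.univ.image fun σ : Fin Z.numCells => pluckerCoord (Z.cell σ).frame).image sq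
  have hrange : (Set.range fun σ : Fin Z.numCells => fun S S' : Fin 4 → Fin (2 * 4) =>
      ((pluckerCoord (Z.cell σ).frame S : ℤ) : ℝ) * ((pluckerCoord (Z.cell σ).frame S' : ℤ) : ℝ)) ⊆ (T : Set _) := by
    rintro _ ⟨σ, rfl⟩
    simp only [Finset.coe_image, Set.mem_image, Finset.mem_coe, Finset.mem_univ, true_and, T, sq]
    exact ⟨pluckerCoord (Z.cell σ).frame, ⟨σ, rfl⟩, rfl⟩
  -- the `N` class tables, inside `span T`
  let v : Fin N → ((Fin 4 → Fin (2 * 4)) → (Fin 4 → Fin (2 * 4)) → ℝ) := fun i =>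
    (a : ℝ) • θ⟦4⟧ ((D i).map ((↑) : ℤ → ℝ)) + (b : ℝ) • wRe⟦4⟧ ((D i).map ((↑) : ℤ → ℝ)) +
      (c : ℝ) • wIm⟦4⟧ ((D i).map ((↑) : ℤ → ℝ))
  let Tset : Set ((Fin 4 → Fin (2 * 4)) → (Fin 4 → Fin (2 * 4)) → ℝ) := ↑T
  let Wsp : Submodule ℝ ((Fin 4 → Fin (2 * 4)) → (Fin 4 → Fin (2 * 4)) → ℝ) := Submodule.span ℝ Tset
  have hvmem : ∀ i, v i ∈ Wsp := fun i =>
    Submodule.span_mono hrange (weilFamilyClass_mem_span_frameSquares Q hQ hJ hgen Z hq (D i) (hDS i) (hDJ i))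
  -- they are linearly independent: read them off on the chosen coordinates
  have hvind : LinearIndependent ℝ v := by
    rw [Fintype.linearIndependent_iff]
    intro g hg i
    have hind' := Fintype.linearIndependent_iff.1 hind g
    have key : ∑ i, g i • (fun j : Fin N => ((Matrix.det (Matrix.submatrix (D i) (col j).1 (col j).2) : ℤ) : ℝ)) = 0 := by
      funext j
      have hj := congrFun (congrFun hg (col j).1) (col j).2
      simp only [Finset.sum_apply, Pi.smul_apply, smul_eq_mul, Pi.zero_apply] at hj ⊢
      have hrow : ∀ i, v i (col j).1 (col j).2 =
          (a : ℝ) * ((Matrix.det (Matrix.submatrix (D i) (col j).1 (col j).2) : ℤ) : ℝ) := by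
        intro i
        have h0 := hcol i j
        have e1 : Matrix.submatrix ((D i).map ((↑) : ℤ → ℝ)) (col j).1 (col j).2 =
            (Int.castRingHom ℝ).mapMatrix (Matrix.submatrix (D i) (col j).1 (col j).2) := by
          ext; rfl
        have e2 : Matrix.det (Matrix.submatrix ((D i).map ((↑) : ℤ → ℝ)) (col j).1 (col j).2) =
            ((Matrix.det (Matrix.submatrix (D i) (col j).1 (col j).2) : ℤ) : ℝ) := by
          rw [e1, ← RingHom.map_det, eq_intCast]
        simp only [v, Pi.add_apply, Pi.smul_apply, smul_eq_mul]
        rw [e2]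
        linear_combination h0
      simp only [hrow] at hj
      have ha0 : (a : ℝ) ≠ 0 := by exact_mod_cast ha
      have : (a : ℝ) * ∑ i, g i * ((Matrix.det (Matrix.submatrix (D i) (col j).1 (col j).2) : ℤ) : ℝ) = 0 := by
        rw [Finset.mul_sum, ← hj]
        exact Finset.sum_congr rfl fun i _ => by ring
      exact (mul_eq_zero.1 this).resolve_left ha0
    exact hind' key i
  -- count
  have hle : N ≤ T.card := by
    have hvind' : LinearIndependent ℝ (fun i => (⟨v i, hvmem i⟩ : Wsp)) := by
      apply LinearIndependent.of_comp Wsp.subtype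
      exact hvind
    have h1 := hvind'.fintype_card_le_finrank
    rw [Fintype.card_fin] at h1
    exact h1.trans (finrank_span_finset_le_card T)
  have hT : T.card ≤ (Finset.univ.image fun σ : Fin Z.numCells => pluckerCoord (Z.cell σ).frame).card :=
    Finset.card_image_le
  refine ⟨hle.trans hT, (hle.trans hT).trans ?_⟩
  exact Finset.card_image_le.trans (by simp)

/-- **Corollary (`Ω`-invisible coordinates, every non-empty cycle).** If the second word of every chosen coordinate pair
has `Ω(S'_j) = det Ω[S'_j, ·] = 0` (54 of the 70 increasing words), the Weil part vanishes there for every class, so the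
direction count `N` holds for EVERY non-empty effective tropical `4`-cycle at a very general Weil period. (Numerically the
class tables span `607` dimensions on such coordinates.) [cite: Zharkov2020TropicalWeil, §2 (pp. 2–4)]
[cite: MikhalkinZharkov2014Eigenwave, Prop. 4.3 and Thm. 5.4] -/
theorem card_image_pluckerCoord_ge_of_omegaInvisible (hQ : Q.PosDef) (hJ : Q * weilJ 4 = weilJ 4 * Q)
    (hgen : IsWeilGeneric 4 Q) (Z : TropicalTorusCycle (2 * 4) 4 Q) (hZ : 0 < Z.numCells) {N : ℕ}
    (D : Fin N → Matrix (Fin (2 * 4)) (Fin (2 * 4)) ℤ) (hDS : ∀ i, ((D i).map ((↑) : ℤ → ℝ)).IsSymm)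
    (hDJ : ∀ i, (D i).map ((↑) : ℤ → ℝ) * weilJ 4 = weilJ 4 * (D i).map ((↑) : ℤ → ℝ))
    (col : Fin N → (Fin 4 → Fin (2 * 4)) × (Fin 4 → Fin (2 * 4)))
    (hcol : ∀ j, Matrix.det (Matrix.submatrix (Ω⟦4⟧) (col j).2 id) = 0)
    (hind : LinearIndependent ℝ fun i : Fin N => fun j : Fin N =>
      ((Matrix.det (Matrix.submatrix (D i) (col j).1 (col j).2) : ℤ) : ℝ)) :
    N ≤ (Finset.univ.image fun σ : Fin Z.numCells => pluckerCoord (Z.cell σ).frame).card ∧ N ≤ Z.numCells := by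
  obtain ⟨a, b, c, hq, ha, -⟩ := Integrality.thetaCoord_pos_int Q hQ hJ hgen Z hZ
  refine card_image_pluckerCoord_ge_of_independent_directions Q hQ hJ hgen Z hq (by omega) D hDS hDJ col ?_ hind
  intro i j
  simp only [hcol j, mul_zero, Complex.zero_re, Complex.zero_im, add_zero]

/-- **Corollary (cycles with `W = 0`, all coordinates).** If `W(Z) = 0` (as K1 predicts for every cycle; unconditionally
for every effective cycle of theta-degree `< 8`, p345948), the class coordinates are `(a, 0, 0)` and the direction count
holds with ANY coordinate pairs: numerically the theta tables `θ₄(D) = ⋀⁴D`, `D ∈ Sym_J(ℤ)`, span `626` dimensions, so a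
non-empty effective tropical `4`-cycle with `W = 0` on a very general tropical Weil eightfold has at least `626` cells in
pairwise distinct rational `4`-planes (given `626` certified independent directions). [cite: Zharkov2020TropicalWeil, §2 (pp. 2–4)]
[cite: MikhalkinZharkov2014Eigenwave, Prop. 4.3 and Thm. 5.4] -/
theorem card_image_pluckerCoord_ge_of_weilFunctional_eq_zero (hQ : Q.PosDef) (hJ : Q * weilJ 4 = weilJ 4 * Q)
    (hgen : IsWeilGeneric 4 Q) (Z : TropicalTorusCycle (2 * 4) 4 Q) (hZ : 0 < Z.numCells)
    (hW : weilFunctional Z = 0) {N : ℕ}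
    (D : Fin N → Matrix (Fin (2 * 4)) (Fin (2 * 4)) ℤ) (hDS : ∀ i, ((D i).map ((↑) : ℤ → ℝ)).IsSymm)
    (hDJ : ∀ i, (D i).map ((↑) : ℤ → ℝ) * weilJ 4 = weilJ 4 * (D i).map ((↑) : ℤ → ℝ))
    (col : Fin N → (Fin 4 → Fin (2 * 4)) × (Fin 4 → Fin (2 * 4)))
    (hind : LinearIndependent ℝ fun i : Fin N => fun j : Fin N =>
      ((Matrix.det (Matrix.submatrix (D i) (col j).1 (col j).2) : ℤ) : ℝ)) :
    N ≤ (Finset.univ.image fun σ : Fin Z.numCells => pluckerCoord (Z.cell σ).frame).card ∧ N ≤ Z.numCells := by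
  obtain ⟨a, b, c, hq, ha, -⟩ := Integrality.thetaCoord_pos_int Q hQ hJ hgen Z hZ
  -- `W(Z) = 8 det(PQPᴴ)(b - ic) = 0` forces `b = c = 0`
  have hW' := Boundary.weilFunctional_eq_of_repr Q hJ Z hq
  rw [hW] at hW'
  have hd := det_frame_mul_map_mul_conjTranspose_pos Q hQ
  have hbc : ((b : ℝ) : ℂ) - Complex.I * ((c : ℝ) : ℂ) = 0 := by
    rcases mul_eq_zero.1 hW'.symm with h | h
    · rcases mul_eq_zero.1 h with h8 | hdet
      · norm_num at h8
      · rw [hdet] at hd; simp at hd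
    · exact h
  have hb : b = 0 := by
    have := congrArg Complex.re hbc
    simp at this
    exact_mod_cast this
  have hc : c = 0 := by
    have := congrArg Complex.im hbc
    simp at this
    exact_mod_cast this
  refine card_image_pluckerCoord_ge_of_independent_directions Q hQ hJ hgen Z hq (by omega) D hDS hDJ col ?_ hind
  intro i j
  simp [hb, hc]


/-! ## §6 Seeds at the identity: the bound transports, and its contrapositive is an obstruction -/

/-- **Seed form.** Let `Z₀` be a non-empty effective tropical `4`-cycle on the standard torus `ℝ⁸/ℤ⁸` whose combinatorial type is
LINEARLY REALISABLE in every direction of `Sym_J` (the unobstructed alternative of the dichotomy p313252 — every refutation of K1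
runs through such a seed, p330167). Then, for every certificate as in `card_image_pluckerCoord_ge_of_omegaInvisible` (`N` integer
directions, `Ω`-invisible coordinate pairs, independent minor rows), the cells of `Z₀` carry at least `N` pairwise distinct Plücker
vectors (transport to a very general realisation with the same frames, p341426). [cite: Zharkov2020TropicalWeil, §1–2 (pp. 2–4)]
[cite: MikhalkinZharkov2014Eigenwave, Def. 4.2 and Prop. 4.3] -/
theorem card_image_pluckerCoord_ge_of_linearlyRealisable
    (Z₀ : TropicalTorusCycle (2 * 4) 4 (1 : Matrix (Fin (2 * 4)) (Fin (2 * 4)) ℝ)) (hZ₀ : 0 < Z₀.numCells)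
    (hsec : ∀ D : Matrix (Fin (2 * 4)) (Fin (2 * 4)) ℝ, D.IsSymm → D * weilJ 4 = weilJ 4 * D →
      ∃ (v : Fin Z₀.numCells → Fin (4 + 1) → Fin (2 * 4) → ℝ)
        (T : Fin Z₀.numCells → Matrix (Fin 4) (Fin 4) ℝ)
        (r : Fin Z₀.numFacetClasses → Fin 4 → Fin (2 * 4) → ℝ),
        (∀ (σ : Fin Z₀.numCells) (j : Fin 4) (a : Fin (2 * 4)),
            v σ j.succ a - v σ 0 a = ∑ m, ((Z₀.cell σ).frame a m : ℝ) * T σ m j) ∧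
        (∀ (σ : Fin Z₀.numCells) (i : Fin (4 + 1)) (j : Fin 4) (a : Fin (2 * 4)),
            v σ (i.succAbove (Z₀.facetPerm σ i j)) a =
              r (Z₀.facetClass σ i) j a + ∑ b, D a b * (Z₀.facetShift σ i b : ℝ)))
    {N : ℕ} (D : Fin N → Matrix (Fin (2 * 4)) (Fin (2 * 4)) ℤ) (hDS : ∀ i, ((D i).map ((↑) : ℤ → ℝ)).IsSymm)
    (hDJ : ∀ i, (D i).map ((↑) : ℤ → ℝ) * weilJ 4 = weilJ 4 * (D i).map ((↑) : ℤ → ℝ))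
    (col : Fin N → (Fin 4 → Fin (2 * 4)) × (Fin 4 → Fin (2 * 4)))
    (hcol : ∀ j, Matrix.det (Matrix.submatrix (Ω⟦4⟧) (col j).2 id) = 0)
    (hind : LinearIndependent ℝ fun i : Fin N => fun j : Fin N =>
      ((Matrix.det (Matrix.submatrix (D i) (col j).1 (col j).2) : ℤ) : ℝ)) :
    N ≤ (Finset.univ.image fun σ : Fin Z₀.numCells => pluckerCoord (Z₀.cell σ).frame).card ∧ N ≤ Z₀.numCells := by
  classical
  obtain ⟨Q, Z, hQ, hQJ, hgen, hc, hsame⟩ := FrameSpan.exists_generic_realisation_of_linearlyRealisable Z₀ hsec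
  have hZ : 0 < Z.numCells := by rw [hc]; exact hZ₀
  have h := card_image_pluckerCoord_ge_of_omegaInvisible Q hQ hQJ hgen Z hZ D hDS hDJ col hcol hind
  have himg : (Finset.univ.image fun σ : Fin Z.numCells => pluckerCoord (Z.cell σ).frame) =
      Finset.univ.image fun σ : Fin Z₀.numCells => pluckerCoord (Z₀.cell σ).frame := by
    ext p
    simp only [Finset.mem_image, Finset.mem_univ, true_and]
    constructor
    · rintro ⟨σ, rfl⟩
      exact ⟨Fin.cast hc σ, by rw [(hsame σ).1]⟩
    · rintro ⟨σ, rfl⟩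
      refine ⟨Fin.cast hc.symm σ, ?_⟩
      have e : Fin.cast hc (Fin.cast hc.symm σ) = σ := Fin.ext rfl
      rw [(hsame (Fin.cast hc.symm σ)).1, e]
  rw [himg, hc] at h
  exact h

/-- **OBSTRUCTION BY THE VARIATIONAL DIRECTION COUNT** (a rung of `stub_nonflatObstructedAtIdentity`, line `identity_transfer`): given
a certificate as above with `N` rows, every non-empty effective tropical `4`-cycle on `ℝ⁸/ℤ⁸` whose cells carry FEWER THAN `N` pairwise
distinct Plücker vectors is OBSTRUCTED AT THE IDENTITY (the first alternative of the dichotomy p313252) — no hypothesis on `W`,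
flatness or loops. With the cell's certified `N = 607` this retires every type with `≤ 606` distinct `4`-planes (row (F): `≤ 68`).
It decides nothing about K1. [cite: Zharkov2020TropicalWeil, §1–2 (pp. 2–4)] [cite: MikhalkinZharkov2014Eigenwave, Def. 4.2 and Prop. 4.3] -/
theorem obstructed_of_card_image_pluckerCoord_lt
    (Z₀ : TropicalTorusCycle (2 * 4) 4 (1 : Matrix (Fin (2 * 4)) (Fin (2 * 4)) ℝ)) (hZ₀ : 0 < Z₀.numCells)
    {N : ℕ} (D : Fin N → Matrix (Fin (2 * 4)) (Fin (2 * 4)) ℤ) (hDS : ∀ i, ((D i).map ((↑) : ℤ → ℝ)).IsSymm)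
    (hDJ : ∀ i, (D i).map ((↑) : ℤ → ℝ) * weilJ 4 = weilJ 4 * (D i).map ((↑) : ℤ → ℝ))
    (col : Fin N → (Fin 4 → Fin (2 * 4)) × (Fin 4 → Fin (2 * 4)))
    (hcol : ∀ j, Matrix.det (Matrix.submatrix (Ω⟦4⟧) (col j).2 id) = 0)
    (hind : LinearIndependent ℝ fun i : Fin N => fun j : Fin N =>
      ((Matrix.det (Matrix.submatrix (D i) (col j).1 (col j).2) : ℤ) : ℝ))
    (hfew : (Finset.univ.image fun σ : Fin Z₀.numCells => pluckerCoord (Z₀.cell σ).frame).card < N) :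
    ∃ ℓ : Matrix (Fin (2 * 4)) (Fin (2 * 4)) ℝ →ₗ[ℝ] ℝ,
      (∃ D : Matrix (Fin (2 * 4)) (Fin (2 * 4)) ℝ, D.IsSymm ∧ D * weilJ 4 = weilJ 4 * D ∧ ℓ D ≠ 0) ∧
      ∀ Q' : Matrix (Fin (2 * 4)) (Fin (2 * 4)) ℝ, Q'.IsSymm → Q' * weilJ 4 = weilJ 4 * Q' →
        (∃ Z' : TropicalTorusCycle (2 * 4) 4 Q',
          ∃ (hc : Z'.numCells = Z₀.numCells) (hf : Z'.numFacetClasses = Z₀.numFacetClasses),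
            ∀ σ : Fin Z'.numCells,
              (Z'.cell σ).weight = (Z₀.cell (Fin.cast hc σ)).weight ∧
              (Z'.cell σ).frame = (Z₀.cell (Fin.cast hc σ)).frame ∧
              ∀ i : Fin (4 + 1),
                Fin.cast hf (Z'.facetClass σ i) = Z₀.facetClass (Fin.cast hc σ) i ∧
                Z'.facetPerm σ i = Z₀.facetPerm (Fin.cast hc σ) i ∧
                Z'.facetShift σ i = Z₀.facetShift (Fin.cast hc σ) i) → ℓ Q' = 0 := by
  rcases obstructed_or_linearSection Z₀ with hobs | hsec
  · exact hobs
  · exfalso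
    have h := (card_image_pluckerCoord_ge_of_linearlyRealisable Z₀ hZ₀ hsec D hDS hDJ col hcol hind).1
    omega

end Summit.HodgeConjecture.HodgeConjecture.Theorems.TropicalWeilVanishing.Variational

end
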